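import Summits.Parity.BatemanHorn.Theses.IsogenyRedei
import Summits.Parity.BatemanHorn.Theorems.BalancedSemiprimeLayer.Negative.Decoration

/-!
# `PolyMobiusTail` (crux stmt-Parity-0870): what is NOT load-bearing — guards and degenerate slices

Negative-side structure lemmas (cdisprove seat refuter-cdisprove-stmt-Parity-0870-0), all PROVED:

* `polyMobiusTail_iff_withoutLeadingCoeffPos` — `leadingCoeff_pos` is decoration: a coordinate with
  negative leading coefficient is `≤ 0` from some point on (`Int.toNat = 0`, no divisors), and the finitely
  many earlier `n` have bounded divisor tuples, below the cut-off `x^{1-η} → ∞`; so the tail is eventually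
  `0` (`tail_eventually_eq_zero_of_leadingCoeff_neg`, using the tree's
  `BalancedSemiprimeLayer.Negative.exists_eval_nonpos_of_leadingCoeff_neg`).
* `polyMobiusTail_withoutEtaPos_trivial` — the conclusion's `0 < η` is the non-triviality guard: with
  `η = -∑ deg fᵢ` the crux function of ANY system is eventually `0` (`tail_eventually_eq_zero_of_eta_neg`).
* `polyMobiusTail_fin_zero` — the degenerate slice `k = 0` holds (the empty system is a BH system, tree:
  `Summit.Parity.BatemanHorn.Theorems.SystemLSDRealSegment.Negative.isBatemanHornSystem_fin_zero`, and its
  tail vanishes for `x ≥ 1`): not a counterexample.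

Companion files: `Negative/Equivalence.lean` (the crux is `Λ`-Bateman–Horn modulo `TypeIMainTerm`),
`Negative/CancellationAcrossN.lean` (tightness at `η = 1`, refuted strengthenings),
`Negative/LinearSlice.lean` (the crux holds on `f = (X)`).
-/

namespace Summit.Parity.BatemanHorn.Theorems.PolyMobiusTail.Negative

open scoped BigOperators
open Filter Asymptotics Polynomial ArithmeticFunction
open Literature.NumberTheory.Sieve
open Summit.Parity.BatemanHorn.Theses.IsogenyRedei (PolyMobiusTail TypeIMainTerm)
open Summit.Parity.BatemanHorn.Theorems.BalancedSemiprimeLayer.Negative (exists_eval_nonpos_of_leadingCoeff_neg)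

/-! ### `leadingCoeff_pos` is decoration -/

/-- If some coordinate has negative leading coefficient, the crux function is eventually `0`
(for every `η < 1`). [folklore] -/
theorem tail_eventually_eq_zero_of_leadingCoeff_neg {k : ℕ} (f : Fin k → ℤ[X]) {j : Fin k}
    (hj : (f j).leadingCoeff < 0) {η : ℝ} (hη : η < 1) :
    ∀ᶠ x : ℕ in atTop, (∑ n ∈ Finset.Icc 1 x,
      ∑ d ∈ Fintype.piFinset (fun i => (((f i).eval (n : ℤ)).toNat).divisors),
        if (x : ℝ) ^ (1 - η) < ∏ i, (d i : ℝ) then ∏ i, ((moebius (d i) : ℝ) * Real.log (d i)) else 0) = 0 := by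
  obtain ⟨M, hM⟩ := exists_eval_nonpos_of_leadingCoeff_neg hj
  -- a bound for the divisor tuples of the finitely many `n < M`
  set B : ℕ := ∑ n ∈ Finset.range M, ∏ i, (((f i).eval (n : ℤ)).toNat) with hB
  have hgrow : Tendsto (fun x : ℕ => (x : ℝ) ^ (1 - η)) atTop atTop :=
    (tendsto_rpow_atTop (by linarith)).comp tendsto_natCast_atTop_atTop
  filter_upwards [hgrow.eventually_ge_atTop (B : ℝ)] with x hx
  refine Finset.sum_eq_zero fun n hn => ?_
  by_cases hMn : M ≤ n
  · -- the `j`-th value is `≤ 0`: no divisors, empty `piFinset`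
    have h0 : (((f j).eval (n : ℤ)).toNat).divisors = ∅ := by
      rw [Int.toNat_of_nonpos (hM n hMn), Nat.divisors_zero]
    have hempty : Fintype.piFinset (fun i => (((f i).eval (n : ℤ)).toNat).divisors) = ∅ :=
      Fintype.piFinset_eq_empty.mpr ⟨j, h0⟩
    rw [hempty, Finset.sum_empty]
  · refine Finset.sum_eq_zero fun d hd => ?_
    rw [if_neg]
    refine not_lt.mpr (le_trans ?_ hx)
    have hdi : ∀ i, (d i : ℝ) ≤ ((((f i).eval (n : ℤ)).toNat : ℕ) : ℝ) := fun i =>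
      Nat.cast_le.mpr (Nat.divisor_le (Fintype.mem_piFinset.mp hd i))
    calc ∏ i, (d i : ℝ) ≤ ∏ i, ((((f i).eval (n : ℤ)).toNat : ℕ) : ℝ) :=
          Finset.prod_le_prod (fun i _ => Nat.cast_nonneg _) fun i _ => hdi i
      _ = ((∏ i, (((f i).eval (n : ℤ)).toNat) : ℕ) : ℝ) := by push_cast; rfl
      _ ≤ (B : ℝ) := by
          exact_mod_cast Finset.single_le_sum (f := fun n : ℕ => ∏ i, (((f i).eval (n : ℤ)).toNat))
            (fun _ _ => Nat.zero_le _) (Finset.mem_range.mpr (not_le.mp hMn))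

/-- **`leadingCoeff_pos` is NOT load-bearing**: `PolyMobiusTail` is equivalent to its variant with the
positivity field dropped (a negative coordinate makes the tail eventually `0`). [folklore] -/
theorem polyMobiusTail_iff_withoutLeadingCoeffPos :
    PolyMobiusTail ↔ ∀ (k : ℕ) (f : Fin k → ℤ[X]), (∀ i, Irreducible (f i)) →
      (Pairwise fun i j => ¬Associated (f i) (f j)) → HasNoFixedPrimeDivisor f →
        ∃ η : ℝ, 0 < η ∧ η < 1 ∧ (fun x : ℕ => ∑ n ∈ Finset.Icc 1 x,
          ∑ d ∈ Fintype.piFinset (fun i => (((f i).eval (n : ℤ)).toNat).divisors),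
            if (x : ℝ) ^ (1 - η) < ∏ i, (d i : ℝ) then ∏ i, ((moebius (d i) : ℝ) * Real.log (d i)) else 0)
          =o[atTop] fun x : ℕ => (x : ℝ) := by
  constructor
  · intro h k f hirr hpw hnf
    by_cases hpos : ∀ i, 0 < (f i).leadingCoeff
    · exact h k f ⟨hirr, hpos, hpw, hnf⟩
    · push Not at hpos
      obtain ⟨j, hj⟩ := hpos
      have hne : (f j).leadingCoeff ≠ 0 := leadingCoeff_ne_zero.mpr (hirr j).ne_zero
      have hlt : (f j).leadingCoeff < 0 := lt_of_le_of_ne hj hne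
      refine ⟨1 / 2, by norm_num, by norm_num, ?_⟩
      refine (isLittleO_zero (fun x : ℕ => (x : ℝ)) atTop).congr' ?_ EventuallyEq.rfl
      filter_upwards [tail_eventually_eq_zero_of_leadingCoeff_neg f hlt (by norm_num : (1 / 2 : ℝ) < 1)]
        with x hx
      exact hx.symm
  · intro h k f hf
    exact h k f hf.irreducible hf.pairwise_not_associated hf.hasNoFixedPrimeDivisor

/-! ### The conclusion's `0 < η` is the non-triviality guard -/

/-- Crude polynomial growth along `ℕ`: `f(n) ≤ (∑ⱼ |aⱼ|) · n^{deg f}` for `n ≥ 1`, in `toNat` form. [folklore] -/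
theorem toNat_eval_le_mul_pow (g : ℤ[X]) {n : ℕ} (hn : 1 ≤ n) :
    (g.eval (n : ℤ)).toNat ≤ (∑ j ∈ Finset.range (g.natDegree + 1), (g.coeff j).natAbs) * n ^ g.natDegree := by
  rw [Int.toNat_le]
  push_cast
  rw [eval_eq_sum_range, Finset.sum_mul]
  refine le_trans (Finset.abs_sum_le_sum_abs _ _ |> le_trans (le_abs_self _)) ?_
  refine Finset.sum_le_sum fun j hj => ?_
  rw [abs_mul, abs_pow]
  refine mul_le_mul_of_nonneg_left ?_ (abs_nonneg _)
  rw [abs_of_nonneg (by positivity)]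
  exact pow_le_pow_right₀ (by exact_mod_cast hn) (Nat.lt_succ_iff.mp (Finset.mem_range.mp hj))

/-- **The conclusion's `0 < η` is the non-triviality guard.** For EVERY system `f` (no hypothesis) and
`η := -∑ᵢ deg fᵢ ≤ 0`, the crux function is eventually `0`: a divisor tuple has
`∏ dᵢ ≤ ∏ fᵢ(n) ≤ (∏ᵢ ∑ⱼ|aᵢⱼ|) · x^{∑ deg fᵢ} ≤ x^{1-η}` once `x ≥ ∏ᵢ ∑ⱼ |aᵢⱼ|`, so the bracket
`x^{1-η} < ∏ dᵢ` never holds. Hence `PolyMobiusTail` with `0 < η` dropped is trivially true. [folklore] -/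
theorem tail_eventually_eq_zero_of_eta_neg {k : ℕ} (f : Fin k → ℤ[X]) :
    ∀ᶠ x : ℕ in atTop, (∑ n ∈ Finset.Icc 1 x,
      ∑ d ∈ Fintype.piFinset (fun i => (((f i).eval (n : ℤ)).toNat).divisors),
        if (x : ℝ) ^ (1 - (-(((∑ i, (f i).natDegree : ℕ)) : ℝ))) < ∏ i, (d i : ℝ) then
          ∏ i, ((moebius (d i) : ℝ) * Real.log (d i)) else 0) = 0 := by
  set S : ℕ := ∑ i, (f i).natDegree with hS
  set B : Fin k → ℕ := fun i => ∑ j ∈ Finset.range ((f i).natDegree + 1), ((f i).coeff j).natAbs with hB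
  filter_upwards [eventually_ge_atTop (∏ i, B i), eventually_ge_atTop 1] with x hx hx1
  have hexp : (x : ℝ) ^ (1 - (-((S : ℕ) : ℝ))) = ((x ^ (S + 1) : ℕ) : ℝ) := by
    rw [sub_neg_eq_add, show (1 : ℝ) + (S : ℝ) = ((S + 1 : ℕ) : ℝ) by push_cast; ring,
      Real.rpow_natCast]
    push_cast; rfl
  refine Finset.sum_eq_zero fun n hn => Finset.sum_eq_zero fun d hd => ?_
  rw [hexp, if_neg]
  obtain ⟨hn1, hnx⟩ := Finset.mem_Icc.mp hn
  have hdi : ∀ i, d i ≤ B i * x ^ (f i).natDegree := fun i =>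
    (Nat.divisor_le (Fintype.mem_piFinset.mp hd i)).trans
      ((toNat_eval_le_mul_pow (f i) hn1).trans (Nat.mul_le_mul_left _ (Nat.pow_le_pow_left hnx _)))
  have hprod : ∏ i, d i ≤ x ^ (S + 1) := by
    calc ∏ i, d i ≤ ∏ i, (B i * x ^ (f i).natDegree) :=
          Finset.prod_le_prod' fun i _ => hdi i
      _ = (∏ i, B i) * x ^ S := by
          rw [Finset.prod_mul_distrib, Finset.prod_pow_eq_pow_sum]
      _ ≤ x * x ^ S := Nat.mul_le_mul_right _ hx
      _ = x ^ (S + 1) := by ring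
  rw [not_lt]
  exact_mod_cast hprod

/-- `PolyMobiusTail` with the constraint `0 < η` dropped holds for EVERY system (trivially, with
`η = -∑ deg fᵢ`): positivity of `η` is what makes the crux say anything. [folklore] -/
theorem polyMobiusTail_withoutEtaPos_trivial {k : ℕ} (f : Fin k → ℤ[X]) :
    ∃ η : ℝ, η < 1 ∧ (fun x : ℕ => ∑ n ∈ Finset.Icc 1 x,
      ∑ d ∈ Fintype.piFinset (fun i => (((f i).eval (n : ℤ)).toNat).divisors),
        if (x : ℝ) ^ (1 - η) < ∏ i, (d i : ℝ) then ∏ i, ((moebius (d i) : ℝ) * Real.log (d i)) else 0)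
      =o[atTop] fun x : ℕ => (x : ℝ) := by
  refine ⟨-(((∑ i, (f i).natDegree : ℕ)) : ℝ), by linarith [Nat.cast_nonneg (α := ℝ) (∑ i, (f i).natDegree)], ?_⟩
  refine (isLittleO_zero (fun x : ℕ => (x : ℝ)) atTop).congr' ?_ EventuallyEq.rfl
  filter_upwards [tail_eventually_eq_zero_of_eta_neg f] with x hx
  exact hx.symm

/-! ### The degenerate slice `k = 0` -/

/-- The `k = 0` slice of `PolyMobiusTail` holds: for `x ≥ 1` the only divisor tuple is the empty one,
`∏ dᵢ = 1 ≤ x^{1-η}`, so the tail is identically `0` — the degenerate case is not a counterexample. [folklore] -/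
theorem polyMobiusTail_fin_zero (f : Fin 0 → ℤ[X]) :
    ∃ η : ℝ, 0 < η ∧ η < 1 ∧ (fun x : ℕ => ∑ n ∈ Finset.Icc 1 x,
      ∑ d ∈ Fintype.piFinset (fun i => (((f i).eval (n : ℤ)).toNat).divisors),
        if (x : ℝ) ^ (1 - η) < ∏ i, (d i : ℝ) then ∏ i, ((moebius (d i) : ℝ) * Real.log (d i)) else 0)
      =o[atTop] fun x : ℕ => (x : ℝ) := by
  refine ⟨1 / 2, by norm_num, by norm_num, ?_⟩
  refine (isLittleO_zero (fun x : ℕ => (x : ℝ)) atTop).congr' ?_ EventuallyEq.rfl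
  filter_upwards [eventually_ge_atTop 1] with x hx
  symm
  refine Finset.sum_eq_zero fun n _ => Finset.sum_eq_zero fun d _ => ?_
  rw [if_neg]
  simp only [Finset.univ_eq_empty, Finset.prod_empty, not_lt]
  exact Real.one_le_rpow (by exact_mod_cast hx) (by norm_num)

end Summit.Parity.BatemanHorn.Theorems.PolyMobiusTail.Negative
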